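import Literature.AnabelianGeometry.AbsoluteAnabelian.AbsTopIThm26vFullModelInstances
import Summits.ABC.IUTFork.MLFGaloisTFG
import HarnessLib

/-!
# [AbsTopI] Thm 2.6 (v), general form (`Θ ⊆ Π`): the `G_k`-finite-generation input DISCHARGED

S. Mochizuki, *Topics in Absolute Anabelian Geometry I: Generalities* (2012) [AbsTopI], Thm 2.6 (v),
manuscript p. 22: "`ζ̃(Π) := ζ(Π/Θ) = [k : ℚ_p]` [...] the kernel of the quotient `Π ↠ G` may be
characterized [...] as the intersection of the open subgroups `H ⊆ Π` such that
`ζ̃(H)/ζ̃(Π) = [Π : H]`" — typed `FundamentalExtension.Thm26vFull` (abc-iut-L4-t4,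
`AbsTopIThm26iii.lean`).

abc-iut cell (block C, seat abc-iut-w6-d034; L4-lead RULING #7k «THM26V-FULL-CLOSE»).  The Literature
side (`AbsTopIThm26vFullCore/Closers/SigmaProofs/ModelInstances.lean`) proves the general-`Θ` form in the
regime `Σ ≠ Primes` from `Δ` tfg (Prop 2.2), `Δ` pro-`Σ` and "`Π` topologically finitely generated",
the last being "[NSW] Thm 7.5.10" for `G_k` plus Prop 2.2 — and `G_k` tfg is a theorem of the tree only
Summits-side (`Summit.ABC.IUTFork.isTopologicallyFinitelyGenerated_absoluteGaloisGroup_padic`, via Tate's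
local Euler–Poincaré characteristic `localEulerPoincareCharacteristic_holds`; abc-iut GAP G-L4t4-2).  This
PROOF-ONLY file (no definitions) performs that discharge, as `MLFGaloisTFG.lean` did for Thm 2.6 (ii):

* `FundamentalExtension.MLFBase.thm26vFull_of_isProSet'` — for EVERY extension with MLF base data,
  `Δ` tfg and pro-`Σ` with `Σ ∌ q` for some prime `q`: `E.Thm26vFull B` (inputs: Prop 2.2 BY NAME and
  the construction datum only);
* `FundamentalExtension.MLFBase.thm26vFull_of_isProSigmaCompletion'` — the model class of print
  (`Δ` a pro-`Σ` completion of a finitely generated group), ZERO further binders;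
* `exists_geomSlimElastic_thm26vFull` — closed non-vacuity: for every prime `p` an MLF-based extension
  with `Δ` tfg, slim, elastic (`≠ 1`), pro-`{2}` satisfying `Thm26vFull` (there `Θ = Δ ≠ {1}`).

HONEST FRAMING: refereed, undisputed [AbsTopI]; the regime `Σ = Primes` of the general form still
carries the rank identity of (ii) and clause two of (iii) as named inputs (Literature closer
`MLFBase.thm26vFull_of_isProSet_of_tfg`); nothing here bears on [IUTchIII] Cor. 3.12; typed ≠ proved
elsewhere.
-/

noncomputable section

namespace Summit.ABC.IUTFork

open Literature.AnabelianGeometry.AbsoluteAnabelian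
open Literature.AnabelianGeometry.SemiGraphs.SemiGraphOfAnabelioids

universe u

/-- **[AbsTopI] Thm 2.6 (v), GENERAL form (`Θ`, `ζ̃`), regime `Σ ≠ Primes`, with "`G_k` tfg"
DISCHARGED**: for every extension `1 → Δ → Π → G → 1` with MLF base data `G ≅ G_K`, GIVEN ONLY
[AbsTopI] Prop 2.2 BY NAME (`E.GeomTFG`) and the construction datum "`Δ` pro-`Σ`" for a set of primes
`Σ` missing some prime: the typed `E.Thm26vFull B`. [cite: MochizukiAbsTopI2012, Thm 2.6 (v) p.22] -/
theorem _root_.Literature.AnabelianGeometry.AbsoluteAnabelian.FundamentalExtension.MLFBase.thm26vFull_of_isProSet'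
    {E : FundamentalExtension.{0}} (B : E.MLFBase) {S : Set ℕ} (hS : S ⊆ {q | q.Prime})
    (hq : ∃ q : ℕ, q.Prime ∧ q ∉ S) (hΔ : E.GeomTFG) (hΔS : IsProSet E.geom S) : E.Thm26vFull B :=
  FundamentalExtension.MLFBase.thm26vFull_of_exists_prime_not_mem B hS hq hΔ
    (IsTopologicallyFinitelyGenerated.of_extension E.aug E.aug_surjective hΔ
      (FundamentalExtension.isTopologicallyFinitelyGenerated_gal_of_mlfBase B)) hΔS

/-- **[AbsTopI] Thm 2.6 (v), general form, on the model class of print, unconditionally**: `Δ` a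
pro-`Σ` completion of a finitely generated group, `Σ ⊆ Primes` missing a prime, MLF base data.
[cite: MochizukiAbsTopI2012, Thm 2.6 (v) p.22] -/
theorem _root_.Literature.AnabelianGeometry.AbsoluteAnabelian.FundamentalExtension.MLFBase.thm26vFull_of_isProSigmaCompletion'
    {E : FundamentalExtension.{0}} (B : E.MLFBase) {Γ : Type u} [Group Γ] [Group.FG Γ]
    {S : Set ℕ} {ι : Γ →* E.geom} (hι : IsProSigmaCompletion S ι) (hS : S ⊆ {q | q.Prime})
    (hq : ∃ q : ℕ, q.Prime ∧ q ∉ S) : E.Thm26vFull B :=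
  FundamentalExtension.MLFBase.thm26vFull_of_isProSigmaCompletion B hι hS hq
    (FundamentalExtension.isTopologicallyFinitelyGenerated_gal_of_mlfBase B)

/-- **Closed non-vacuity of the general-`Θ` [AbsTopI] Thm 2.6 (v)**: for every prime `p` there is an
extension with MLF base data (`G = G_{ℚ_p}`) whose `Δ` is topologically finitely generated, slim and
elastic (hence nontrivial) and pro-`{2}` — the product model `Δ̂ × G_{ℚ_p}` with `Δ̂` a pro-`2`
completion of `Γ_{0,3} ≅ F₂` — satisfying the typed `Thm26vFull`; in it `Θ = Δ ≠ {1}`.  Zero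
hypotheses. [cite: MochizukiAbsTopI2012, Thm 2.6 (v) p.22] -/
theorem exists_geomSlimElastic_thm26vFull (p : ℕ) [Fact p.Prime] :
    ∃ (E : FundamentalExtension.{0}) (B : E.MLFBase),
      E.GeomTFG ∧ E.GeomSlimElastic ∧ IsProSet E.geom {2} ∧ E.Thm26vFull B :=
  FundamentalExtension.exists_mlfBase_geom_ne_bot_thm26vFull p
    (fun q hq => by rw [Set.mem_singleton_iff] at hq; subst hq; exact Nat.prime_two)
    ⟨2, rfl, Nat.prime_two⟩ ⟨3, Nat.prime_three, by simp⟩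
    (fun p _ K _ _ _ => isTopologicallyFinitelyGenerated_absoluteGaloisGroup_padic p K)

end Summit.ABC.IUTFork

end
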